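import Summits.CriticalPhenomena.SAWScalingLimit.Theorems.SAWRenewalTightnessAnnularMassDecayLastRenewalDefs

/-!
# Crux `SAWRenewalTightness.AnnularMassDecay` (stmt-CriticalPhenomena-4729), line `last-renewal-delocalization`:
# S2c `stub_kraftOfCount` — the abstract Kraft inequality at the critical fugacity

Registered stub `stub_kraftOfCount` of the checked skeleton of the line.  Let `B` be a finite family of blocks
`b = (n_b, w_b)` with lengths `n_b ≤ M` and generating polynomial `P(x) = Σ_{b ∈ B} x^{n_b}`.  If the counting
inequality `Σ_{k ≤ K} P(x)^k ≤ Σ_{n ≤ K M} c_n x^n` (`c_n = SAW.Zd.count 2 n`, the number of `n`-step self-avoiding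
walks on `ℤ²`) holds for every `0 < x < x_c` and every `K` — this is what unique decodability of the code `B` gives,
supplied by the neighbouring stub S2b — then `P(x_c) ≤ 1` at the critical fugacity `x_c = SAW.criticalFugacity = 1/μ`.

Proof (Kesten 1963 §4; Madras–Slade 1993, Corollary 3.1.8 and §4.2, the easy half `A(z_c) ≤ 1` of (4.2.4)).
* `lkc_sum_pow_lt_one` — for `0 < x < x_c = z_c(2)` (`SAW.Zd.criticalPoint_two`) the susceptibility series
  `Σ_n c_n x^n` is summable (`SAW.Zd.summable_count_mul_pow`), so the right-hand side is bounded by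
  `χ(x) = ∑' n, c_n x^n` uniformly in `K`; if `P(x) ≥ 1` the left-hand side is `≥ K + 1`, absurd for `K = ⌈χ(x)⌉₊`.
  Hence `P(x) < 1` on `(0, x_c)`.
* `stub_kraftOfCount` — `P` is a polynomial, hence continuous; if `P(x_c) > 1` then `P > 1` on a left neighbourhood
  of `x_c`, which meets `(0, x_c)` since `0 < x_c` (`Negative.criticalFugacity_pos`): contradiction.  (The idiom of
  `StripMass.sum_pow_criticalFugacity_le_one` / `KestenIdentity.partialSum_le_one` in the tree.)

Sources: H. Kesten, *On the number of self-avoiding walks*, J. Math. Phys. 4 (1963), §4;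
N. Madras, G. Slade, *The Self-Avoiding Walk* (1993), Corollary 3.1.8 and §4.2, eq. (4.2.4).
-/

noncomputable section

namespace Summit.CriticalPhenomena.SAWScalingLimit.Theorems.AnnularMassDecay.LastRenewal

open scoped BigOperators Classical ComplexConjugate Topology
open Filter
open Literature.Probability.LatticeModels Literature.Probability.RandomPlanarGeometry
open Summit.CriticalPhenomena.SAWScalingLimit.Theorems.AnnularMassDecay.Negative (criticalFugacity_pos)

/-! ## Subcritical strictness: `P(x) < 1` for `0 < x < x_c` -/

/-- If `1 ≤ P` then `K + 1 ≤ Σ_{k ≤ K} P^k`. [folklore] -/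
theorem lkc_succ_le_sum_pow {P : ℝ} (hP : 1 ≤ P) (K : ℕ) :
    (K : ℝ) + 1 ≤ ∑ k ∈ Finset.range (K + 1), P ^ k :=
  calc (K : ℝ) + 1 = ∑ _k ∈ Finset.range (K + 1), (1 : ℝ) := by simp
    _ ≤ ∑ k ∈ Finset.range (K + 1), P ^ k := Finset.sum_le_sum fun k _ => one_le_pow₀ hP

/-- **Subcritical strictness.** Under the counting inequality `Σ_{k ≤ K} P(x)^k ≤ Σ_{n ≤ K M} c_n x^n` (all
`0 < x < x_c`, all `K`), the generating polynomial satisfies `P(x) < 1` for every `0 < x < x_c`: the right-hand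
side is at most the (finite, `x < x_c = z_c`) susceptibility `χ(x) = Σ_n c_n x^n`, while `P(x) ≥ 1` would make the
left-hand side `≥ K + 1` for every `K`. [cite: MadrasSlade1993, §4.2, eq. (4.2.4)] -/
theorem lkc_sum_pow_lt_one (B : Finset (ℕ × (ℕ → Site 2))) (M : ℕ)
    (hcount : ∀ x : ℝ, 0 < x → x < SAW.criticalFugacity → ∀ K : ℕ,
        ∑ k ∈ Finset.range (K + 1), (∑ b ∈ B, x ^ b.1) ^ k ≤
          ∑ n ∈ Finset.range (K * M + 1), (SAW.Zd.count 2 n : ℝ) * x ^ n)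
    {x : ℝ} (hx : 0 < x) (hxc : x < SAW.criticalFugacity) :
    ∑ b ∈ B, x ^ b.1 < 1 := by
  by_contra hge
  rw [not_lt] at hge
  -- the susceptibility series converges strictly below `x_c = z_c(2)`
  have hsum : Summable fun n : ℕ => (SAW.Zd.count 2 n : ℝ) * x ^ n :=
    SAW.Zd.summable_count_mul_pow hx (by rwa [SAW.Zd.criticalPoint_two])
  set χ : ℝ := ∑' n, (SAW.Zd.count 2 n : ℝ) * x ^ n with hχ
  -- take `K = ⌈χ⌉₊`: then `K + 1 ≤ Σ_{k ≤ K} P^k ≤ Σ_{n ≤ K M} c_n x^n ≤ χ ≤ K`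
  have h1 : (⌈χ⌉₊ : ℝ) + 1 ≤ ∑ k ∈ Finset.range (⌈χ⌉₊ + 1), (∑ b ∈ B, x ^ b.1) ^ k :=
    lkc_succ_le_sum_pow hge _
  have h2 : ∑ n ∈ Finset.range (⌈χ⌉₊ * M + 1), (SAW.Zd.count 2 n : ℝ) * x ^ n ≤ χ :=
    hsum.sum_le_tsum _ fun n _ => by positivity
  have h3 : χ ≤ (⌈χ⌉₊ : ℝ) := Nat.le_ceil χ
  have h4 := hcount x hx hxc ⌈χ⌉₊
  linarith

/-! ## The registered stub -/

/-- **S2c · `stub_kraftOfCount`** — ABSTRACT KRAFT INEQUALITY AT THE CRITICAL FUGACITY.  If a finite family of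
blocks with lengths `n_b ≤ M` satisfies the counting inequality `Σ_{k ≤ K} P(x)^k ≤ Σ_{n ≤ K M} c_n x^n` for all
`0 < x < x_c` and all `K` (`P(x) = Σ_b x^{n_b}`, `c_n` the number of `n`-step SAWs on `ℤ²`), then `P(x_c) ≤ 1`.
By `lkc_sum_pow_lt_one`, `P < 1` on `(0, x_c)`; `P` is continuous and `0 < x_c`, so `P(x_c) ≤ 1` (otherwise
`P > 1` on a left neighbourhood of `x_c`).  This is the easy half `A(z_c) ≤ 1` of Kesten's identity.
[cite: MadrasSlade1993, §4.2, eq. (4.2.4)] -/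
theorem stub_kraftOfCount :
    ∀ (B : Finset (ℕ × (ℕ → Site 2))) (M : ℕ), (∀ b ∈ B, b.1 ≤ M) →
      (∀ x : ℝ, 0 < x → x < SAW.criticalFugacity → ∀ K : ℕ,
          ∑ k ∈ Finset.range (K + 1), (∑ b ∈ B, x ^ b.1) ^ k ≤
            ∑ n ∈ Finset.range (K * M + 1), (SAW.Zd.count 2 n : ℝ) * x ^ n) →
      ∑ b ∈ B, SAW.criticalFugacity ^ b.1 ≤ 1 := by
  intro B M _hM hcount
  by_contra hgt
  rw [not_le] at hgt
  have hxc : 0 < SAW.criticalFugacity := criticalFugacity_pos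
  -- the polynomial `z ↦ Σ_b z^{n_b}` is continuous and `> 1` at `x_c`, hence `> 1` at some `0 < z < x_c`
  have hcont : Continuous fun z : ℝ => ∑ b ∈ B, z ^ b.1 :=
    continuous_finsetSum B fun b _ => continuous_pow b.1
  have h1 : ∀ᶠ z in 𝓝 SAW.criticalFugacity, 1 < ∑ b ∈ B, z ^ b.1 :=
    hcont.continuousAt.eventually (lt_mem_nhds hgt)
  have h2 : ∀ᶠ z in 𝓝[<] SAW.criticalFugacity,
      (1 < ∑ b ∈ B, z ^ b.1) ∧ z ∈ Set.Ioo 0 SAW.criticalFugacity :=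
    (h1.filter_mono nhdsWithin_le_nhds).and (Ioo_mem_nhdsLT hxc)
  obtain ⟨z, hz1, hz0, hzlt⟩ := h2.exists
  exact absurd (lkc_sum_pow_lt_one B M hcount hz0 hzlt) (not_lt.2 hz1.le)

end Summit.CriticalPhenomena.SAWScalingLimit.Theorems.AnnularMassDecay.LastRenewal
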